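import Summits.ResolutionOfSingularities.ResolutionOfSingularities.Theorems.EquisingularLiftEquisingularLiftNatSpecimenSteinerPointStep
import Summits.ResolutionOfSingularities.ResolutionOfSingularities.Theorems.EquisingularLiftEquisingularLiftNatNoseHypPointsFirstSchema
import HarnessLib

/-!
# [OURS · L1 W4.5(b) · EL♮(3) · NOSE, N-2 brick (C), part 1] «STEINER ∈ ν2» ASSEMBLED MODULO ITS NAMED DOWNSTAIRS CLAUSES; clause (a) `Z′` infinite DISCHARGED

res-L1-w45b-nose-w2 g2 (WIDTH seat on D-0157 DOOR 1, nose row; desk GO «N-2» 2026-08-28T18:37:40Z). OURS; NOT a statement of any manuscript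
([Hironaka2017] is a candidate under adjudication, nothing of it is asserted); AI-written, weaker than expert review. No `sorry`; standard axioms;
DEF-FREE (the specimen files' standing `attribute [local instance]` for the `Proj k[x]` spelling). `--kind proof --supports
stmt-ResolutionOfSingularities-20148 --as helper`; closes nothing. Resolution of singularities in positive characteristic is NOT proved here or anywhere in
this chain (dimension 3 is Cossart–Piltant 2008/2009 in print); EL♮(3) is NOT proved by this file.

WHAT. The (H-ν2) schema (brick (A) ✓ p658017 `noseHypPointsFirstBTriplePrime_of_pointStep_oneBlowup`) fed with the Steiner point step (brick (B)
`…NatSpecimenSteinerPointStep`: the point of `(range ι)^` over the triple point `P = vertex 2 k` is NON-regular, `ℙ³` regular at `P`, `Bl_P ℙ³` regular,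
`Z′ = ⋃ᵢ vertexLineStrict υ i ⊆ St`, `St ⊄ Z′`):

★ `Steiner.noseHypPointsFirstBTriplePrime_of_clauses` — for `k` algebraically closed, ANY blowing up `υ : F₂ ⟶ ℙ³_k` of `𝓘{P}` and ANY blowing up
`υ' : F₃ ⟶ F₂` of `𝓘⟨Z′⟩`, the Roman surface `S = V₊(x₀²x₁² + x₁²x₂² + x₂²x₀² + x₀x₁x₂x₃)` satisfies the 36th registration's hypothesis
`NoseHypPointsFirstBTriplePrime k 3 S ι` PROVIDED the four downstairs clauses of the nose move hold for `Z′ ⊂ F₂`: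
  (a) `Z′` infinite, (b) the curve clause and `Z̃′` regular, (c) `DirStepUnobs F₂ univ _ Z′` (`H¹(Z̃′, 𝒩) = 0`), (d) the reduced strict transform
  `(closure υ'⁻¹(St ∖ Z′))~` regular (ONE blow-up of the three disjoint lines resolves; EMPTY B‴ phase).
Each clause is a NAMED hypothesis of this theorem, in the tree's exact currency, so that its supplier lands it BY TYPE: (a)/(b) = res-L1-w45b-nose-w3 g2
HANDOFF «open (a)», (c) = D3-9 ⊙ p658224 `dirStepUnobs_univ_vertexLineStrict` per line + the ×3 union call (desk R40), (d) = (P5) of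
`STEINER-TEST.md` (ring level ✓ p649392 `Steiner.isRegularRing_chart₁/₂/chartFar₁/₂`; scheme-level transport L–XL, open). HONEST STATUS: this is
«Steiner ∈ ν2» MODULO (a)–(d), not the certificate itself; the certificate is this theorem with the four hypotheses discharged.
§2 DISCHARGES (a): `iUnion_vertexLineStrict_infinite` (`k = k̄` is infinite; the punctured line `V₊(x₁,x₂) ∖ {P}` — the chart images of the points
`(0,0,t)` of `Spec k[y]` under `u₀ = chartι k 3 0` — lifts injectively into `vertexLineStrict υ 0 ⊆ Z′`), whence ★ `noseHypPointsFirstBTriplePrime_of_clauses'`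
= «Steiner ∈ ν2» MODULO (b)(c)(d) only.
-/

set_option linter.dupNamespace false -- mandated namespace `Summit.<Summit>.<Problem>` of this single-conjunct summit

noncomputable section

open CategoryTheory CategoryTheory.Limits AlgebraicGeometry TopologicalSpace
open MvPolynomial
open Literature.AlgebraicGeometry.Resolution Literature.AlgebraicGeometry.Resolution.DeJong1996
open Literature.AlgebraicGeometry.Motives Literature.AlgebraicGeometry.Motives.SmoothHypersurface
open Literature.AlgebraicGeometry.Motives.ProjectiveSpace
open AlgebraicGeometry.Scheme.IdealSheafData
open Summit.ResolutionOfSingularities.ResolutionOfSingularities.Theorems.EquisingularLift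

attribute [local instance] MvPolynomial.gradedAlgebra ProjBaseChange.algebraBase

namespace Summit.ResolutionOfSingularities.ResolutionOfSingularities.Cruxes.EquisingularLiftNat.Sections

namespace Steiner

variable (k : Type) [Field k] [IsAlgClosed k]

/-- ★ **«STEINER ∈ ν2» MODULO ITS NAMED DOWNSTAIRS CLAUSES.** For `k = k̄`, the Roman surface `S ↪ ℙ³_k`, ANY blowing up `υ : F₂ ⟶ ℙ³` of the triple
point `P` and ANY blowing up `υ' : F₃ ⟶ F₂` of the three strict-transform lines `Z′ = ⋃ᵢ vertexLineStrict υ i`: if (a) `Z′` is infinite, (b) `Z̃′` has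
one-dimensional local rings at its closed points and is regular, (c) `DirStepUnobs F₂ univ _ Z′`, and (d) the reduced strict transform
`(closure υ'⁻¹(St ∖ Z′))~` of `S` in `F₃` is regular (`St = closure υ⁻¹(ι(S) ∖ {P})`), then `NoseHypPointsFirstBTriplePrime k 3 S ι` — ONE E1-legal point
step at `P` (brick (B): the point over `P` is non-regular on `(range ι)^`, `ℙ³` regular at `P`), ONE nose move at `Z′` with the EMPTY B‴ chain (brick (A)).
[OURS · L1 W4.5b · «Steiner ∈ ν2» assembled modulo (a)–(d)] -/
theorem noseHypPointsFirstBTriplePrime_of_clauses {F₂ : Scheme.{0}} {υ : F₂ ⟶ SpecimenQuarticTcDelta.P3 k}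
    (hυ : IsBlowup υ (vertexIdealSheaf 2 k))
    (hZinf : (⋃ i : Fin 3, vertexLineStrict υ i).Infinite)
    (hcurve : ∀ z : ↥(redSub F₂ (⋃ i : Fin 3, vertexLineStrict υ i) (isClosed_iUnion_vertexLineStrict υ)),
      IsClosed ({z} : Set ↥(redSub F₂ (⋃ i : Fin 3, vertexLineStrict υ i) (isClosed_iUnion_vertexLineStrict υ))) →
      ringKrullDim ((redSub F₂ (⋃ i : Fin 3, vertexLineStrict υ i) (isClosed_iUnion_vertexLineStrict υ)).presheaf.stalk z) =
        ((1 : ℕ) : WithBot ℕ∞))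
    (hZreg : ∀ x : redSub F₂ (⋃ i : Fin 3, vertexLineStrict υ i) (isClosed_iUnion_vertexLineStrict υ),
      IsRegularLocalRing ((redSub F₂ (⋃ i : Fin 3, vertexLineStrict υ i) (isClosed_iUnion_vertexLineStrict υ)).presheaf.stalk x))
    (hunobs : DirStepUnobs F₂ Set.univ isClosed_univ (⋃ i : Fin 3, vertexLineStrict υ i) (isClosed_iUnion_vertexLineStrict υ))
    {F₃ : Scheme.{0}} {υ' : F₃ ⟶ F₂}
    (hυ' : IsBlowup υ' (vanishingIdeal (⟨⋃ i : Fin 3, vertexLineStrict υ i, isClosed_iUnion_vertexLineStrict υ⟩ : Closeds F₂)))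
    (hfin : Scheme.IsRegular (vanishingIdeal (⟨closure (υ' ⁻¹'
      (closure (υ ⁻¹' (Set.range (hypersurfaceι (form k)).left \ {vertex 2 k})) \ ⋃ i : Fin 3, vertexLineStrict υ i)),
        isClosed_closure⟩ : Closeds F₃)).subscheme) :
    NoseHypPointsFirstBTriplePrime k 3 (hypersurface (form k)).left (hypersurfaceι (form k)).left := by
  obtain ⟨x, hx⟩ := exists_point_over_vertex k
  -- the point-step clauses at `x` (brick (B)), rewritten from `vertex 2 k` to `T̂ι x`
  have hxcl : IsClosed ({((vanishingIdeal (⟨closure (Set.range (hypersurfaceι (form k)).left), isClosed_closure⟩ :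
      Closeds (SpecimenQuarticTcDelta.P3 k))).subschemeι x : SpecimenQuarticTcDelta.P3 k)} : Set (SpecimenQuarticTcDelta.P3 k)) := by
    rw [hx]; exact isClosed_singleton_vertex 2 k
  have hxT := not_isRegularLocalRing_over_vertex k x hx
  have hxF : IsRegularLocalRing ((SpecimenQuarticTcDelta.P3 k).presheaf.stalk
      ((vanishingIdeal (⟨closure (Set.range (hypersurfaceι (form k)).left), isClosed_closure⟩ :
        Closeds (SpecimenQuarticTcDelta.P3 k))).subschemeι x)) := by
    rw [hx]; exact isRegularLocalRing_stalk_vertex k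
  have eC : (⟨{((vanishingIdeal (⟨closure (Set.range (hypersurfaceι (form k)).left), isClosed_closure⟩ :
      Closeds (SpecimenQuarticTcDelta.P3 k))).subschemeι x : SpecimenQuarticTcDelta.P3 k)}, hxcl⟩ : Closeds (SpecimenQuarticTcDelta.P3 k)) =
      ⟨{vertex 2 k}, isClosed_singleton_vertex 2 k⟩ := Closeds.ext (by simp only [Closeds.coe_mk]; rw [hx])
  have hυx : IsBlowup υ (vanishingIdeal (⟨{((vanishingIdeal (⟨closure (Set.range (hypersurfaceι (form k)).left), isClosed_closure⟩ :
      Closeds (SpecimenQuarticTcDelta.P3 k))).subschemeι x : SpecimenQuarticTcDelta.P3 k)}, hxcl⟩ : Closeds (SpecimenQuarticTcDelta.P3 k))) := by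
    rw [eC]; exact hυ
  -- the nose-set clauses (brick (B)), rewritten likewise
  have hZT : (⋃ i : Fin 3, vertexLineStrict υ i) ⊆ closure (υ ⁻¹' (Set.range (hypersurfaceι (form k)).left \
      {((vanishingIdeal (⟨closure (Set.range (hypersurfaceι (form k)).left), isClosed_closure⟩ :
        Closeds (SpecimenQuarticTcDelta.P3 k))).subschemeι x : SpecimenQuarticTcDelta.P3 k)})) := by
    rw [hx]; exact iUnion_vertexLineStrict_subset_strict υ
  have hTZ : ¬ (closure (υ ⁻¹' (Set.range (hypersurfaceι (form k)).left \
      {((vanishingIdeal (⟨closure (Set.range (hypersurfaceι (form k)).left), isClosed_closure⟩ :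
        Closeds (SpecimenQuarticTcDelta.P3 k))).subschemeι x : SpecimenQuarticTcDelta.P3 k)})) ⊆ ⋃ i : Fin 3, vertexLineStrict υ i) := by
    rw [hx]; exact not_strict_subset_iUnion_vertexLineStrict hυ
  have eC₃ : (⟨closure (υ' ⁻¹' (closure (υ ⁻¹' (Set.range (hypersurfaceι (form k)).left \
      {((vanishingIdeal (⟨closure (Set.range (hypersurfaceι (form k)).left), isClosed_closure⟩ :
        Closeds (SpecimenQuarticTcDelta.P3 k))).subschemeι x : SpecimenQuarticTcDelta.P3 k)})) \ ⋃ i : Fin 3, vertexLineStrict υ i)),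
        isClosed_closure⟩ : Closeds F₃) =
      ⟨closure (υ' ⁻¹' (closure (υ ⁻¹' (Set.range (hypersurfaceι (form k)).left \ {vertex 2 k})) \ ⋃ i : Fin 3, vertexLineStrict υ i)),
        isClosed_closure⟩ := Closeds.ext (by simp only [Closeds.coe_mk]; rw [hx])
  have hfin' : Scheme.IsRegular (vanishingIdeal (⟨closure (υ' ⁻¹' (closure (υ ⁻¹' (Set.range (hypersurfaceι (form k)).left \
      {((vanishingIdeal (⟨closure (Set.range (hypersurfaceι (form k)).left), isClosed_closure⟩ :
        Closeds (SpecimenQuarticTcDelta.P3 k))).subschemeι x : SpecimenQuarticTcDelta.P3 k)})) \ ⋃ i : Fin 3, vertexLineStrict υ i)),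
        isClosed_closure⟩ : Closeds F₃)).subscheme := by
    rw [eC₃]; exact hfin
  exact noseHypPointsFirstBTriplePrime_of_pointStep_oneBlowup k 3 (hypersurface (form k)).left (hypersurfaceι (form k)).left x hxcl hxT hxF
    F₂ υ hυx (⋃ i : Fin 3, vertexLineStrict υ i) (isClosed_iUnion_vertexLineStrict υ) hZT hTZ hZinf hcurve hZreg
    (ambient_clause_of_isBlowup_vertex hυ _ _) hunobs F₃ υ' hυ' hfin'


/-! ## §2 Clause (a) discharged: the nose set `Z′` is infinite (`k` algebraically closed, hence infinite) -/

omit [IsAlgClosed k] in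
/-- The points `(0, 0, t)`, `t ∈ k`, of `Spec k[y₀,y₁,y₂]`: the maximal ideals `ker (eval (0,0,t))`, pairwise distinct. [folklore] -/
theorem injective_pointOnAxis :
    Function.Injective fun t : k =>
      (⟨RingHom.ker (MvPolynomial.eval (![0, 0, t] : Fin 3 → k)),
        (RingHom.ker_isMaximal_of_surjective (MvPolynomial.eval (![0, 0, t] : Fin 3 → k)) fun a => ⟨C a, eval_C a⟩).isPrime⟩ :
          Spec (CommRingCat.of (MvPolynomial (Fin 3) k))) := by
  intro t s h
  have hmem : (X 2 - C t : MvPolynomial (Fin 3) k) ∈ RingHom.ker (MvPolynomial.eval (![0, 0, s] : Fin 3 → k)) := by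
    have h' := congrArg (fun q : Spec (CommRingCat.of (MvPolynomial (Fin 3) k)) => q.asIdeal) h
    simp only at h'
    rw [← h', RingHom.mem_ker, map_sub, eval_X, eval_C]
    simp
  rw [RingHom.mem_ker, map_sub, eval_X, eval_C] at hmem
  have h0 : s - t = 0 := by simpa using hmem
  exact (sub_eq_zero.mp h0).symm

omit [IsAlgClosed k] in
/-- The chart images `u₀(0,0,t) ∈ ℙ³` of those points lie on the line `vertexLine 2 k 0 = V₊(x₁, x₂)` and off the vertex (they lie in `D₊(x₀)`). [folklore] -/
theorem chartι_zero_pointOnAxis_mem (t : k) :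
    (ProjectiveSpaceCells.chartι k 3 0)
        ⟨RingHom.ker (MvPolynomial.eval (![0, 0, t] : Fin 3 → k)),
          (RingHom.ker_isMaximal_of_surjective (MvPolynomial.eval (![0, 0, t] : Fin 3 → k)) fun a => ⟨C a, eval_C a⟩).isPrime⟩ ∈
      vertexLine 2 k 0 \ {vertex 2 k} := by
  set q : Spec (CommRingCat.of (MvPolynomial (Fin 3) k)) := ⟨RingHom.ker (MvPolynomial.eval (![0, 0, t] : Fin 3 → k)),
    (RingHom.ker_isMaximal_of_surjective (MvPolynomial.eval (![0, 0, t] : Fin 3 → k)) fun a => ⟨C a, eval_C a⟩).isPrime⟩ with hq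
  refine ⟨?_, ?_⟩
  · -- on the line: `x₁ = u₀-image of y₀`, `x₂ = u₀-image of y₁` vanish at `q`
    intro j hj
    have hj' : ∃ j' : Fin 3, Fin.succAbove (0 : Fin 4) j' = Fin.castSucc j ∧ (MvPolynomial.X j' : MvPolynomial (Fin 3) k) ∈ q.asIdeal := by
      fin_cases j
      · exact absurd rfl hj
      · exact ⟨0, by decide, by change (X 0 : MvPolynomial (Fin 3) k) ∈ RingHom.ker _; rw [RingHom.mem_ker, eval_X]; rfl⟩
      · exact ⟨1, by decide, by change (X 1 : MvPolynomial (Fin 3) k) ∈ RingHom.ker _; rw [RingHom.mem_ker, eval_X]; rfl⟩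
    obtain ⟨j', hjj', hmem⟩ := hj'
    have hz : q ∈ PrimeSpectrum.zeroLocus {(MvPolynomial.X j' : MvPolynomial (Fin 3) k)} :=
      (SpecimenQuarticTcDelta.mem_zeroLocus_singleton_iff' q _).mpr hmem
    rw [← ProjectiveSpaceCells.chartι_preimage_zeroLocus_X k 3 0 j'] at hz
    have hz' : (ProjectiveSpaceCells.chartι k 3 0) q ∈
        ProjectiveSpectrum.zeroLocus (homogeneousSubmodule (Fin (3 + 1)) k) {(X (Fin.succAbove (0 : Fin 4) j') : MvPolynomial (Fin 4) k)} := hz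
    rw [hjj'] at hz'
    exact (ProjectiveSpectrum.mem_zeroLocus _ _ _).mp hz' (Set.mem_singleton _)
  · -- off the vertex: the image lies in `D₊(x₀)`
    intro h
    have hr : (ProjectiveSpaceCells.chartι k 3 0) q ∈ Set.range (ProjectiveSpaceCells.chartι k 3 0).base := Set.mem_range_self q
    rw [ProjectiveSpaceCells.range_chartι] at hr
    rw [Set.mem_singleton_iff] at h
    rw [h] at hr
    exact vertex_notMem_basicOpen 2 k 0 hr

omit [IsAlgClosed k] in
/-- **The punctured line `V₊(x₁, x₂) ∖ {P}` is infinite** over an infinite field. [folklore] -/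
theorem vertexLine_diff_infinite [Infinite k] : (vertexLine 2 k 0 \ {vertex 2 k}).Infinite :=
  Set.infinite_of_injective_forall_mem
    ((ProjectiveSpaceCells.chartι k 3 0).isOpenEmbedding.injective.comp (injective_pointOnAxis k)) (chartι_zero_pointOnAxis_mem k)

/-- ★ **CLAUSE (a): the nose set `Z′ = ⋃ᵢ vertexLineStrict υ i` is INFINITE** (`k = k̄` is infinite; the punctured line `V₊(x₁,x₂) ∖ {P}` lifts
injectively into `vertexLineStrict υ 0 ⊆ Z′`, `υ` being an isomorphism over `ℙ³ ∖ {P}`). [OURS · L1 W4.5b · clause (a) of «Steiner ∈ ν2»] -/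
theorem iUnion_vertexLineStrict_infinite {F₂ : Scheme.{0}} {υ : F₂ ⟶ SpecimenQuarticTcDelta.P3 k} (hυ : IsBlowup υ (vertexIdealSheaf 2 k)) :
    (⋃ i : Fin 3, vertexLineStrict υ i).Infinite := by
  haveI : Infinite k := IsAlgClosed.instInfinite
  classical
  -- choose a preimage of every point off the vertex
  have hpre : ∀ y : ↥(vertexLine 2 k 0 \ {vertex 2 k}), ∃ y' : F₂, υ y' = y := fun y => exists_preimage_of_ne_vertex hυ y.2.2
  choose g hg using hpre
  have hinj : Function.Injective g := fun a b h => Subtype.ext (by rw [← hg a, ← hg b, h])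
  have hmem : ∀ y, g y ∈ ⋃ i : Fin 3, vertexLineStrict υ i := fun y =>
    Set.mem_iUnion.mpr ⟨0, preimage_diff_subset_vertexLineStrict υ 0 (by rw [Set.mem_preimage, hg]; exact y.2)⟩
  haveI : Infinite ↥(vertexLine 2 k 0 \ {vertex 2 k}) := (vertexLine_diff_infinite k).to_subtype
  exact Set.infinite_of_injective_forall_mem hinj hmem


/-- ★ **«STEINER ∈ ν2» MODULO (b)(c)(d)** — clause (a) discharged by `iUnion_vertexLineStrict_infinite`: for `k = k̄`, any blowing up `υ` of the triple
point and any blowing up `υ'` of `Z′ = ⋃ᵢ vertexLineStrict υ i`, IF (b) `Z̃′` is regular with one-dimensional local rings at closed points, (c)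
`DirStepUnobs F₂ univ _ Z′` and (d) the reduced strict transform of `S` after `υ'` is regular, THEN `NoseHypPointsFirstBTriplePrime k 3 S ι`.
[OURS · L1 W4.5b · «Steiner ∈ ν2» assembled modulo (b)(c)(d)] -/
theorem noseHypPointsFirstBTriplePrime_of_clauses' {F₂ : Scheme.{0}} {υ : F₂ ⟶ SpecimenQuarticTcDelta.P3 k}
    (hυ : IsBlowup υ (vertexIdealSheaf 2 k))
    (hcurve : ∀ z : ↥(redSub F₂ (⋃ i : Fin 3, vertexLineStrict υ i) (isClosed_iUnion_vertexLineStrict υ)),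
      IsClosed ({z} : Set ↥(redSub F₂ (⋃ i : Fin 3, vertexLineStrict υ i) (isClosed_iUnion_vertexLineStrict υ))) →
      ringKrullDim ((redSub F₂ (⋃ i : Fin 3, vertexLineStrict υ i) (isClosed_iUnion_vertexLineStrict υ)).presheaf.stalk z) =
        ((1 : ℕ) : WithBot ℕ∞))
    (hZreg : ∀ x : redSub F₂ (⋃ i : Fin 3, vertexLineStrict υ i) (isClosed_iUnion_vertexLineStrict υ),
      IsRegularLocalRing ((redSub F₂ (⋃ i : Fin 3, vertexLineStrict υ i) (isClosed_iUnion_vertexLineStrict υ)).presheaf.stalk x))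
    (hunobs : DirStepUnobs F₂ Set.univ isClosed_univ (⋃ i : Fin 3, vertexLineStrict υ i) (isClosed_iUnion_vertexLineStrict υ))
    {F₃ : Scheme.{0}} {υ' : F₃ ⟶ F₂}
    (hυ' : IsBlowup υ' (vanishingIdeal (⟨⋃ i : Fin 3, vertexLineStrict υ i, isClosed_iUnion_vertexLineStrict υ⟩ : Closeds F₂)))
    (hfin : Scheme.IsRegular (vanishingIdeal (⟨closure (υ' ⁻¹'
      (closure (υ ⁻¹' (Set.range (hypersurfaceι (form k)).left \ {vertex 2 k})) \ ⋃ i : Fin 3, vertexLineStrict υ i)),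
        isClosed_closure⟩ : Closeds F₃)).subscheme) :
    NoseHypPointsFirstBTriplePrime k 3 (hypersurface (form k)).left (hypersurfaceι (form k)).left :=
  noseHypPointsFirstBTriplePrime_of_clauses k hυ (iUnion_vertexLineStrict_infinite k hυ) hcurve hZreg hunobs hυ' hfin

end Steiner

end Summit.ResolutionOfSingularities.ResolutionOfSingularities.Cruxes.EquisingularLiftNat.Sections

end
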